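import Literature.Geometry.Riemannian.TwoPiProfile
import Literature.Geometry.Riemannian.TwoPiCuspChart
import Literature.Geometry.Riemannian.FillingPieceChart
import Literature.Geometry.Riemannian.LocalIsometryTransport
import Literature.Geometry.Riemannian.PieceMetricNhd
import HarnessLib

/-!
# The Gromov–Thurston `2π` smoothing: the set-up and the glued field of bilinear forms

Support file (everything proved; no named fact, no `sorry`) for the Gromov–Thurston `2π` theorem
`Literature.Geometry.Riemannian.gromovThurston_twoPi_four` (`CuspedHyperbolic.lean`; Anderson
2006, §2.1, (2.4); Bleiler–Hodgson 1996, Thm. 9). Given a hyperbolic `4`-manifold `X` with a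
system `S` of rank-`3` torus cusps, unimodular filling data `A` with all slopes of flat length
`≥ 2π`, and a Dehn filling `P` (`IsDehnFilling S A P`: embeddings `jA : X → P`,
`jB i : T² × D̊² → P` glued along the filling relation), this file fixes all the auxiliary choices
of the proof in one structure `TwoPiSetup g S A P` (`TwoPiSetup.exists`):

* a level `t_h < 0` above which the enlarged cusps are still disjoint (`DehnFillingCusps.lean`);
* per cusp: a slope frame (`TwoPiCoreModel.lean`), the smoothing profile `c` with its constants
  `κ, λ, T` (`TwoPiProfile.lean`, hyperbolic below `t_h/2`, flat-cone above `T`);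

and builds from them

* the charts: the straightened cusp chart `Φ i : E4 → X` (`TwoPiCuspChart.lean`) and the core
  chart `Ψ i : V_core i → P` through the filling piece (`FillingPieceChart.lean`), with the model
  metrics `G i` (one-variable diagonal model on `V_cusp i = {t > t_h}`) and `F i` (flat core form
  on `V_core i = {|w| < δ}`);
* **the glued field of bilinear forms** `gval D : P → (E4 →L E4 →L ℝ)`: on `range jA` the
  push-forward of the modified metric `hatVal` of `X` (the hyperbolic metric, replaced inside the
  enlarged cusps by the push-forward of `G i` along `Φ i`), on the core tori the push-forward of
  `F i` along `Ψ i`;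
* the three **pull-back identities** `Φ^* hatVal = G` (`hatVal_pullback_cuspChart`),
  `jA^* gval = hatVal` (`gval_pullback_jA`), `Ψ^* gval = F` (`gval_pullback_coreChart`), the
  identity `hatVal = g` on the thin part (`hatVal_eq_of_thin`), and the covering of `P` by the
  thin part, the enlarged cusps and the core charts (`cover`).

The metric, its smoothness and its curvature are assembled in `TwoPiAssembly.lean`.

## References

* M. T. Anderson, *Dehn filling and Einstein metrics in higher dimensions*, J. Differential Geom.
  73 (2006) 219–261, §2.1. [Anderson2006]
* S. A. Bleiler, C. D. Hodgson, *Spherical space forms and Dehn filling*, Topology 35 (1996)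
  809–833, Thm. 9. [BleilerHodgson1996]
-/

noncomputable section

open Set Function Filter TopologicalSpace Bundle Real
open scoped Manifold ContDiff Topology InnerProductSpace

namespace Literature.Geometry.Riemannian

open Literature.Geometry.Lorentzian Literature.Geometry.Lorentzian.MetricCoord
  Literature.Geometry.Lorentzian.PseudoRiemannianMetric Literature.Geometry.Manifold
  Literature.Topology.FourManifolds TwoPiCore

/-- Local notation: `𝕊 n` is the unit sphere in `EuclideanSpace ℝ (Fin (n + 1))`. -/
local notation "𝕊 " n:arg => (Metric.sphere (0 : EuclideanSpace ℝ (Fin (n + 1))) 1)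

set_option quotPrecheck false in
/-- Local notation: the model with corners of the filling piece `(𝕊¹ × 𝕊¹) × ℝ²`. -/
local notation "𝓜" =>
  (ModelWithCorners.prod (ModelWithCorners.prod (𝓡 1) (𝓡 1)) 𝓘(ℝ, EuclideanSpace ℝ (Fin 2)))

variable {X : Type*} [TopologicalSpace X] [ChartedSpace E4 X] [IsManifold (𝓡 4) ∞ X]
  {g : PseudoRiemannianMetric (𝓡 4) ∞ E4 (TangentSpace (𝓡 4) : X → Type _)}
  {k : ℕ} {S : TorusCuspSystem g k 3} {A : Fin k → Matrix (Fin 3) (Fin 3) ℤ}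
  {P : Type*} [TopologicalSpace P] [ChartedSpace E4 P]

/-! ### Push-forward of a bilinear form along an injective endomorphism -/

/-- An injective endomorphism of `E4` is a continuous linear equivalence. [folklore] -/
def equivOfInjective (T : E4 →L[ℝ] E4) (hT : Injective T) : E4 ≃L[ℝ] E4 :=
  (LinearEquiv.ofBijective (T : E4 →ₗ[ℝ] E4)
    ⟨hT, (LinearMap.injective_iff_surjective (f := (T : E4 →ₗ[ℝ] E4))).1 hT⟩).toContinuousLinearEquiv

/-- `equivOfInjective T` is `T` as a map. [folklore] -/
@[simp] theorem coe_equivOfInjective (T : E4 →L[ℝ] E4) (hT : Injective T) :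
    ((equivOfInjective T hT : E4 ≃L[ℝ] E4) : E4 →L[ℝ] E4) = T := by
  ext v
  rfl

/-- The **push-forward** `(T_* B)(v, w) = B(T⁻¹ v, T⁻¹ w)` of a bilinear form `B` on `E4`
along an endomorphism `T` (meaningful for `T` invertible; `ContinuousLinearMap.inverse`).
[folklore] -/
def pushBilin (B : E4 →L[ℝ] E4 →L[ℝ] ℝ) (T : E4 →L[ℝ] E4) : E4 →L[ℝ] E4 →L[ℝ] ℝ :=
  B.bilinearComp T.inverse T.inverse

/-- `T⁻¹ (T v) = v` for injective `T`. [folklore] -/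
theorem inverse_apply_self {T : E4 →L[ℝ] E4} (hT : Injective T) (v : E4) : T.inverse (T v) = v := by
  have h : T = ((equivOfInjective T hT : E4 ≃L[ℝ] E4) : E4 →L[ℝ] E4) :=
    (coe_equivOfInjective T hT).symm
  rw [h, ContinuousLinearMap.inverse_equiv]
  exact (equivOfInjective T hT).symm_apply_apply v

/-- **The push-forward pulls back to the form**: `(T_* B)(T v, T w) = B(v, w)`. [folklore] -/
@[simp] theorem pushBilin_apply {T : E4 →L[ℝ] E4} (hT : Injective T) (B : E4 →L[ℝ] E4 →L[ℝ] ℝ)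
    (v w : E4) : pushBilin B T (T v) (T w) = B v w := by
  simp [pushBilin, inverse_apply_self hT]

/-- Two bilinear forms agreeing on the image of a surjective map are equal. [folklore] -/
theorem bilin_eq_of_forall_apply {T : E4 →L[ℝ] E4} (hT : Surjective T)
    {B B' : E4 →L[ℝ] E4 →L[ℝ] ℝ} (h : ∀ v w, B (T v) (T w) = B' (T v) (T w)) : B = B' := by
  ext v w
  obtain ⟨v', rfl⟩ := hT v
  obtain ⟨w', rfl⟩ := hT w
  exact h v' w'

/-- An injective endomorphism of `E4` is surjective. [folklore] -/
theorem surjective_of_injective {T : E4 →L[ℝ] E4} (hT : Injective T) : Surjective T :=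
  (LinearMap.injective_iff_surjective (f := (T : E4 →ₗ[ℝ] E4))).1 hT

/-- **The push-forward is characterised by its pull-back**: if `B'(T v, T w) = B(v, w)` for all
`v, w` and `T` is injective then `B' = T_* B`. [folklore] -/
theorem eq_pushBilin_of_forall {T : E4 →L[ℝ] E4} (hT : Injective T) {B B' : E4 →L[ℝ] E4 →L[ℝ] ℝ}
    (h : ∀ v w, B' (T v) (T w) = B v w) : B' = pushBilin B T :=
  bilin_eq_of_forall_apply (surjective_of_injective hT) fun v w ↦ by rw [h, pushBilin_apply hT]

/-! ### The slope bases -/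

/-- The **slope basis** `(a₀, a₁, a₂)` of the `i`-th cusp: the columns of the filling datum `A i`
as lattice vectors, `a_j = ∑_l A_{lj} v_l`; the slope is `a₂`. [cite: Anderson2006, §2.1] -/
def slopeBasis (S : TorusCuspSystem g k 3) (A : Fin k → Matrix (Fin 3) (Fin 3) ℤ) (i : Fin k) :
    Fin 3 → E3 :=
  fun j ↦ (S.cusp i).latticeVector fun l ↦ A i l j

/-- The flat length of the slope is `‖a₂‖`. [folklore] -/
theorem slopeLength_eq (i : Fin k) :
    (S.cusp i).slopeLength (fun l ↦ A i l 2) = ‖slopeBasis S A i 2‖ := rfl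

/-- The cusp point of the filling relation is `x(θ)` for the slope basis. [folklore] -/
theorem cuspPt_eq_xTheta (i : Fin k) (q : E4) :
    cuspPt (S.cusp i) (A i) (q 0) (q 1) (q 2) = xTheta (slopeBasis S A i) q := by
  simp only [cuspPt, xTheta, slopeBasis, smul_add, smul_smul, div_eq_inv_mul]

/-- **The slope basis is a basis** (`A ∈ GL(3, ℤ)`): every vector of `E3` is `x(θ)`
(`exists_cuspPt_eq`), so the three vectors span, hence are linearly independent. [folklore] -/
theorem linearIndependent_slopeBasis {i : Fin k} (hdet : (A i).det = 1 ∨ (A i).det = -1) :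
    LinearIndependent ℝ (slopeBasis S A i) := by
  refine linearIndependent_of_top_le_span_of_card_eq_finrank ?_ (by simp)
  rintro x -
  obtain ⟨θ₁, θ₂, θ₃, hx⟩ := exists_cuspPt_eq (S.cusp i) (A i) hdet x
  rw [← hx, cuspPt]
  refine Submodule.add_mem _ (Submodule.add_mem _ ?_ ?_) ?_ <;>
    refine Submodule.smul_mem _ _ (Submodule.subset_span ⟨_, rfl⟩)

/-! ### The set-up -/

variable (g S A P) in
/-- **The set-up of the `2π` smoothing**: the Dehn filling data (`jA`, `jB` and the clauses of
`IsDehnFilling`), a level `t_h < 0` with disjoint enlarged cusps, and per cusp a slope frame and a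
smoothing profile with its constants (hyperbolic for `t ≤ t_h/2`, flat-cone for `t ≥ T`,
curvature conditions everywhere). [cite: Anderson2006, §2.1, (2.4)] -/
structure TwoPiSetup where
  /-- The embedding of the cusped manifold. -/
  jA : X → P
  /-- The embeddings of the filling pieces. -/
  jB : Fin k → fillingPiece → P
  /-- The filling data are unimodular. -/
  hdet : ∀ i, (A i).det = 1 ∨ (A i).det = -1
  /-- `jA` is a smooth embedding. -/
  hjA : Manifold.IsSmoothEmbedding (𝓡 4) (𝓡 4) ∞ jA
  /-- `range jA` is open. -/
  hjAo : IsOpen (range jA)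
  /-- The `jB i` are smooth embeddings. -/
  hjB : ∀ i, Manifold.IsSmoothEmbedding 𝓜 (𝓡 4) ∞ (jB i)
  /-- The pieces cover. -/
  hcover : range jA ∪ (⋃ i, range (jB i)) = univ
  /-- The filling pieces are pairwise disjoint. -/
  hdisjB : Pairwise fun i j ↦ Disjoint (range (jB i)) (range (jB j))
  /-- The filling relation. -/
  hrel : ∀ (i : Fin k) (a : X) (b : fillingPiece),
    jA a = jB i b ↔ (S.cusp i).fillingRel (A i) a (b : ((𝕊 1) × (𝕊 1)) × (EuclideanSpace ℝ (Fin 2)))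
  /-- The slopes have flat length `≥ 2π`. -/
  hL : ∀ i, 2 * π ≤ ‖slopeBasis S A i 2‖
  /-- The level of the enlarged cusps. -/
  th : ℝ
  /-- The level is negative. -/
  th_neg : th < 0
  /-- The level is inside every cusp region. -/
  neg_eps_lt_th : ∀ i, -(S.cusp i).eps < th
  /-- The enlarged cusps are pairwise disjoint. -/
  disj : Pairwise fun i j ↦ Disjoint ((S.cusp i) '' {p | th < p.2}) ((S.cusp j) '' {p | th < p.2})
  /-- The slope frames. -/
  fr : ∀ i, SlopeFrame (slopeBasis S A i)
  /-- The smoothing profiles. -/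
  c : Fin k → Fin 4 → ℝ → ℝ
  /-- The `T²`-scale of the core. -/
  κ : Fin k → ℝ
  /-- The disc scale of the core. -/
  lam : Fin k → ℝ
  /-- The height above which the profile has the flat-cone form. -/
  T : Fin k → ℝ
  /-- `κ > 0`. -/
  κ_pos : ∀ i, 0 < κ i
  /-- `λ > 0`. -/
  lam_pos : ∀ i, 0 < lam i
  /-- The profiles are smooth. -/
  c_smooth : ∀ i j, ContDiff ℝ ∞ (c i j)
  /-- The profiles are positive. -/
  c_pos : ∀ i j t, 0 < c i j t
  /-- The profiles are hyperbolic below `t_h / 2`. -/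
  c_hyp : ∀ i t, t ≤ th / 2 → c i 0 t = exp (-2 * t) ∧ c i 1 t = exp (-2 * t) ∧
    c i 2 t = exp (-2 * t) ∧ c i 3 t = 1
  /-- The profiles have the flat-cone form above `T`. -/
  c_core : ∀ i t, T i ≤ t → c i 0 t = κ i ^ 2 ∧ c i 1 t = κ i ^ 2 ∧
    c i 2 t = lam i ^ 2 * (2 * π / ‖slopeBasis S A i 2‖) ^ 2 * exp (-2 * t) ∧
    c i 3 t = lam i ^ 2 * exp (-2 * t)
  /-- The convexity conditions. -/
  c_conv : ∀ i (t : ℝ) (j : Fin 4), j ≠ 3 →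
    0 ≤ deriv (deriv (c i j)) t / 2 - deriv (c i j) t ^ 2 / (4 * c i j t)
      - deriv (c i 3) t * deriv (c i j) t / (4 * c i 3 t)
  /-- The monotonicity conditions. -/
  c_mono : ∀ i (t : ℝ) (j l : Fin 4), j ≠ 3 → l ≠ 3 → j ≠ l → 0 ≤ deriv (c i j) t * deriv (c i l) t

namespace TwoPiSetup

/-- **Existence of the set-up** from a Dehn filling with long slopes (`exists_level_of_dehnFilling`,
`exists_slopeFrame`, `TwoPiProfile.exists_profile`). [cite: Anderson2006, §2.1, (2.4)] -/
theorem «exists» [T2Space X] [T2Space P] (hP : IsDehnFilling S A P)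
    (hL : ∀ i, 2 * π ≤ (S.cusp i).slopeLength fun l ↦ A i l 2) : Nonempty (TwoPiSetup g S A P) := by
  obtain ⟨hdet, jA, jB, hjA, hjAo, hjB, hcover, hdisjB, hrel⟩ := hP
  obtain ⟨th, hth, hthε, hdisj⟩ := exists_level_of_dehnFilling (S := S) (A := A) (jA := jA)
    (jB := jB) hrel hjA.isEmbedding.continuous (fun i ↦ (hjB i).1.isEmbedding.continuous) hdet
  have hL' : ∀ i, 2 * π ≤ ‖slopeBasis S A i 2‖ := fun i ↦ (slopeLength_eq (S := S) (A := A) i) ▸ hL i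
  have hne : ∀ i, slopeBasis S A i 2 ≠ 0 := fun i h ↦ by
    have := hL' i
    rw [h, norm_zero] at this
    linarith [Real.pi_pos]
  have fr : ∀ i, SlopeFrame (slopeBasis S A i) := fun i ↦ Classical.choice (exists_slopeFrame (hne i))
  have hth2 : th / 2 < 0 := by linarith
  have hprof := fun i ↦ TwoPiProfile.exists_profile (a := th / 2) (L := ‖slopeBasis S A i 2‖) hth2
    (hL' i)
  choose c κ lam T hκ hlam hcs hcp hch hcc hconv hmono using hprof
  exact ⟨⟨jA, jB, hdet, hjA, hjAo, fun i ↦ (hjB i).1, hcover, hdisjB, hrel, hL', th, hth, hthε, hdisj,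
    fr, c, κ, lam, T, hκ, hlam, hcs, hcp, hch, hcc, hconv, hmono⟩⟩

variable (D : TwoPiSetup g S A P)

/-! ### Basic properties of the embeddings -/

/-- `jA` is smooth. [folklore] -/
theorem contMDiff_jA : ContMDiff (𝓡 4) (𝓡 4) ∞ D.jA := D.hjA.isImmersion.contMDiff

/-- `jA` is continuous. [folklore] -/
theorem continuous_jA : Continuous D.jA := D.hjA.isEmbedding.continuous

/-- `jA` is injective. [folklore] -/
theorem injective_jA : Injective D.jA := D.hjA.isEmbedding.injective

/-- The differential of `jA` is injective. [folklore] -/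
theorem injective_mfderiv_jA (x : X) : Injective (mfderiv (𝓡 4) (𝓡 4) D.jA x) :=
  injective_mfderiv_of_isImmersionAt' (D.hjA.isImmersion.isImmersionAt x)

/-- The `jB i` are smooth. [folklore] -/
theorem contMDiff_jB (i : Fin k) : ContMDiff 𝓜 (𝓡 4) ∞ (D.jB i) := (D.hjB i).isImmersion.contMDiff

/-- The `jB i` are continuous. [folklore] -/
theorem continuous_jB (i : Fin k) : Continuous (D.jB i) := (D.hjB i).isEmbedding.continuous

/-- The `jB i` are injective. [folklore] -/
theorem injective_jB (i : Fin k) : Injective (D.jB i) := (D.hjB i).isEmbedding.injective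

/-- The differentials of the `jB i` are injective. [folklore] -/
theorem injective_mfderiv_jB (i : Fin k) (b : fillingPiece) :
    Injective (mfderiv 𝓜 (𝓡 4) (D.jB i) b) :=
  injective_mfderiv_of_isImmersionAt' ((D.hjB i).isImmersion.isImmersionAt b)

include D in
/-- The slope basis is linearly independent. [folklore] -/
theorem linearIndependent (i : Fin k) : LinearIndependent ℝ (slopeBasis S A i) :=
  linearIndependent_slopeBasis (D.hdet i)

include D in
/-- The slope is non-zero. [folklore] -/
theorem slope_ne_zero (i : Fin k) : slopeBasis S A i 2 ≠ 0 := fun h ↦ by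
  have := D.hL i
  rw [h, norm_zero] at this
  linarith [Real.pi_pos]

/-- The modification level `a₀ = t_h / 2 ∈ (t_h, 0)`. [folklore] -/
def a₀ : ℝ := D.th / 2

/-- `t_h < a₀`. [folklore] -/
theorem th_lt_a₀ : D.th < D.a₀ := by unfold a₀; linarith [D.th_neg]

/-- `a₀ < 0`. [folklore] -/
theorem a₀_neg : D.a₀ < 0 := by unfold a₀; linarith [D.th_neg]

/-! ### The cusp charts and the cusp models -/

/-- The straightened chart of the `i`-th cusp. [folklore] -/
def Φ (i : Fin k) : E4 → X := (S.cusp i).cuspChart (D.fr i)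

/-- A point of height `> t_h` is in the region of the `i`-th chart. [folklore] -/
theorem region_of_th_lt (i : Fin k) {q : E4} (hq : D.th < q 3) : -(S.cusp i).eps < q 3 :=
  (D.neg_eps_lt_th i).trans hq

/-- The enlarged cusp domain `V_cusp = {q | t_h < q₃}`. [folklore] -/
def Vcusp : Opens E4 :=
  ⟨{q : E4 | D.th < q 3}, isOpen_lt continuous_const
    ((EuclideanSpace.proj (3 : Fin 4) : E4 →L[ℝ] ℝ).continuous)⟩

/-- Membership in `V_cusp`. [folklore] -/
@[simp] theorem mem_Vcusp {q : E4} : q ∈ D.Vcusp ↔ D.th < q 3 := Iff.rfl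

/-- **The cusp model** `G i = ∑ c_{ij}(t) dy_j²` on `V_cusp`. [folklore] -/
def G (i : Fin k) : PseudoRiemannianMetric 𝓘(ℝ, E4) ∞ E4 (TangentSpace 𝓘(ℝ, E4) : D.Vcusp → Type _) :=
  oneVarMetric D.Vcusp (D.c i) (D.c_smooth i) (D.c_pos i)

/-- The value of the cusp model. [folklore] -/
@[simp] theorem G_val (i : Fin k) (q : D.Vcusp) : (D.G i).val q = diagMetric (oneVar (D.c i)) q.1 :=
  rfl

/-- The diagonal model only depends on the height `q₃`. [folklore] -/
theorem diagMetric_oneVar_congr (c : Fin 4 → ℝ → ℝ) {q q' : E4} (h : q 3 = q' 3) :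
    diagMetric (oneVar c) q = diagMetric (oneVar c) q' := by
  simp only [diagMetric_eq, oneVar, h]

/-- The chart `Φ i` lands in the enlarged cusp `C_i '' {t > t_h}`. [folklore] -/
theorem Φ_mem_image (i : Fin k) {q : E4} (hq : D.th < q 3) :
    D.Φ i q ∈ (S.cusp i) '' {p | D.th < p.2} :=
  ⟨TorusCusp.yToX (D.fr i) q, by simpa using hq, rfl⟩

/-- **Points of two different enlarged cusps are different.** [folklore] -/
theorem eq_of_Φ_eq_Φ {i j : Fin k} {q q' : E4} (hq : D.th < q 3) (hq' : D.th < q' 3)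
    (h : D.Φ i q = D.Φ j q') : i = j := by
  by_contra hij
  exact Set.disjoint_left.1 (D.disj hij) (D.Φ_mem_image i hq) (h ▸ D.Φ_mem_image j hq')

/-! ### The core charts and the core models -/

/-- The core height `T_max = max (T, 1)`. [folklore] -/
def Tmax (i : Fin k) : ℝ := max (D.T i) 1

/-- The core radius `δ = e^{-T_max} ≤ e^{-1}`. [folklore] -/
def δ (i : Fin k) : ℝ := exp (-D.Tmax i)

/-- `δ > 0`. [folklore] -/
theorem δ_pos (i : Fin k) : 0 < D.δ i := exp_pos _

/-- `δ < 1`. [folklore] -/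
theorem δ_lt_one (i : Fin k) : D.δ i < 1 := by
  rw [δ, exp_lt_one_iff, neg_lt_zero, Tmax]
  exact lt_of_lt_of_le one_pos (le_max_right _ _)

/-- The core domain `V_core = {q | q₂² + q₃² < δ²}`. [folklore] -/
def Vcore (i : Fin k) : Opens E4 :=
  ⟨{q : E4 | q 2 ^ 2 + q 3 ^ 2 < D.δ i ^ 2}, isOpen_lt
    ((((EuclideanSpace.proj (2 : Fin 4) : E4 →L[ℝ] ℝ).continuous).pow 2).add
      (((EuclideanSpace.proj (3 : Fin 4) : E4 →L[ℝ] ℝ).continuous).pow 2)) continuous_const⟩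

/-- Membership in `V_core`. [folklore] -/
@[simp] theorem mem_Vcore {i : Fin k} {q : E4} : q ∈ D.Vcore i ↔ q 2 ^ 2 + q 3 ^ 2 < D.δ i ^ 2 :=
  Iff.rfl

/-- Points of `V_core` are valid filling-piece parameters. [folklore] -/
theorem Vcore_lt_one (i : Fin k) : ∀ q ∈ D.Vcore i, q 2 ^ 2 + q 3 ^ 2 < 1 := fun q hq ↦ by
  have h1 : D.δ i ^ 2 < 1 := by
    have := D.δ_lt_one i
    have := D.δ_pos i
    nlinarith
  exact lt_trans hq h1

/-- **The core chart** `Ψ i : V_core i → P`, `q ↦ jB ((e^{iq₀}, e^{iq₁}), (q₂, q₃))`. [folklore] -/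
def Ψ (i : Fin k) (q : D.Vcore i) : P := D.jB i (pieceChart (D.Vcore i) (D.Vcore_lt_one i) q)

/-- The core chart is smooth. [folklore] -/
theorem contMDiff_Ψ (i : Fin k) : ContMDiff 𝓘(ℝ, E4) (𝓡 4) ∞ (D.Ψ i) :=
  (D.contMDiff_jB i).comp contMDiff_pieceChart

/-- **Chain rule for the core chart.** [folklore] -/
theorem mfderiv_Ψ (i : Fin k) (q : D.Vcore i) :
    mfderiv 𝓘(ℝ, E4) (𝓡 4) (D.Ψ i) q =
      (mfderiv 𝓜 (𝓡 4) (D.jB i) (pieceChart (D.Vcore i) (D.Vcore_lt_one i) q)).comp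
        (mfderiv 𝓘(ℝ, E4) 𝓜 pieceParam q.1) := by
  rw [← mfderiv_pieceChart (hV := D.Vcore_lt_one i)]
  exact mfderiv_comp q ((D.contMDiff_jB i).mdifferentiableAt (by simp))
    (contMDiff_pieceChart.mdifferentiableAt (by simp))

/-- The differential of the core chart is injective. [folklore] -/
theorem injective_mfderiv_Ψ (i : Fin k) (q : D.Vcore i) :
    Injective (mfderiv 𝓘(ℝ, E4) (𝓡 4) (D.Ψ i) q) := by
  rw [mfderiv_Ψ]
  exact (D.injective_mfderiv_jB i _).comp (injective_mfderiv_pieceParam q.1)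

/-- **The core model** `F i` on `V_core`: the flat core form of the slope frame. [folklore] -/
def F (i : Fin k) : PseudoRiemannianMetric 𝓘(ℝ, E4) ∞ E4 (TangentSpace 𝓘(ℝ, E4) : D.Vcore i → Type _) :=
  riemannianOfRepr (D.Vcore i) ((D.fr i).coreForm (D.κ i) (D.lam i))
    ((D.fr i).contDiff_coreForm (D.κ i) (D.lam i)).contDiffOn
    (fun q _ v w ↦ (D.fr i).coreForm_symm (D.κ i) (D.lam i) q v w)
    (fun q _ v hv ↦ (D.fr i).coreForm_pos (D.linearIndependent i) (D.κ_pos i).ne' (D.lam_pos i).ne'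
      q v hv)

/-- The value of the core model. [folklore] -/
@[simp] theorem F_val (i : Fin k) (q : D.Vcore i) :
    (D.F i).val q = (D.fr i).coreForm (D.κ i) (D.lam i) q.1 := rfl

/-! ### The modified field of bilinear forms on `X` -/

/-- **The modified metric of `X`** (as a field of bilinear forms on `E4 = T_x X`): inside the
enlarged cusps `Φ i ({t > t_h})` the push-forward of the cusp model `G i` along the chart,
elsewhere the hyperbolic metric `g`. [cite: Anderson2006, §2.1, (2.4)] -/
def hatVal (x : X) : E4 →L[ℝ] E4 →L[ℝ] ℝ :=
  open scoped Classical in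
  if h : ∃ iq : Fin k × E4, D.th < iq.2 3 ∧ D.Φ iq.1 iq.2 = x then
    pushBilin (diagMetric (oneVar (D.c h.choose.1)) h.choose.2)
      (mfderiv 𝓘(ℝ, E4) (𝓡 4) (D.Φ h.choose.1) h.choose.2)
  else g.val x

/-- The differential of a cusp chart is injective on the enlarged cusp. [folklore] -/
theorem injective_mfderiv_Φ (i : Fin k) {q : E4} (hq : D.th < q 3) :
    Injective (mfderiv 𝓘(ℝ, E4) (𝓡 4) (D.Φ i) q) :=
  (S.cusp i).injective_mfderiv_cuspChart (D.fr i) (D.region_of_th_lt i hq)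

/-- Two parameters of the same cusp point give the same push-forward. [folklore] -/
theorem push_eq_push_of_Φ_eq {i i' : Fin k} {q q' : E4} (hq : D.th < q 3) (hq' : D.th < q' 3)
    (h : D.Φ i' q' = D.Φ i q) :
    pushBilin (diagMetric (oneVar (D.c i')) q') (mfderiv 𝓘(ℝ, E4) (𝓡 4) (D.Φ i') q') =
      pushBilin (diagMetric (oneVar (D.c i)) q) (mfderiv 𝓘(ℝ, E4) (𝓡 4) (D.Φ i) q) := by
  have hi : i' = i := D.eq_of_Φ_eq_Φ hq' hq h
  subst hi
  obtain ⟨ℓ, hℓ, rfl⟩ := (S.cusp i').exists_latShift_of_cuspChart_eq (D.fr i')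
    (D.region_of_th_lt i' hq) (D.region_of_th_lt i' hq') h.symm
  rw [diagMetric_oneVar_congr (D.c i') (TorusCusp.add_latShift_apply_three (D.fr i') q ℓ)]
  have hd : mfderiv 𝓘(ℝ, E4) (𝓡 4) (D.Φ i') (q + TorusCusp.latShift (D.fr i') ℓ) =
      mfderiv 𝓘(ℝ, E4) (𝓡 4) (D.Φ i') q :=
    (S.cusp i').mfderiv_cuspChart_add_latShift (D.fr i') (D.region_of_th_lt i' hq) hℓ
  exact congrArg (fun T ↦ pushBilin (diagMetric (oneVar (D.c i')) q) T) hd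

/-- The value of the modified field at a point of an enlarged cusp. [folklore] -/
theorem hatVal_Φ (i : Fin k) {q : E4} (hq : D.th < q 3) :
    D.hatVal (D.Φ i q) =
      pushBilin (diagMetric (oneVar (D.c i)) q) (mfderiv 𝓘(ℝ, E4) (𝓡 4) (D.Φ i) q) := by
  have h : ∃ iq : Fin k × E4, D.th < iq.2 3 ∧ D.Φ iq.1 iq.2 = D.Φ i q := ⟨(i, q), hq, rfl⟩
  unfold hatVal
  rw [dif_pos h]
  exact D.push_eq_push_of_Φ_eq hq h.choose_spec.1 h.choose_spec.2

/-- **`Φ^* hatVal = G`**: the modified field pulls back along the cusp chart to the cusp model.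
[folklore] -/
theorem hatVal_pullback_Φ (i : Fin k) {q : E4} (hq : D.th < q 3) (v w : E4) :
    D.hatVal (D.Φ i q) (mfderiv 𝓘(ℝ, E4) (𝓡 4) (D.Φ i) q v)
      (mfderiv 𝓘(ℝ, E4) (𝓡 4) (D.Φ i) q w) = diagMetric (oneVar (D.c i)) q v w := by
  rw [D.hatVal_Φ i hq]
  exact pushBilin_apply (D.injective_mfderiv_Φ i hq) _ v w

/-- **`hatVal = g` on the thin part**: at a point all of whose cusp parameters (if any) have
height `< a₀ = t_h/2`, where the profiles are still hyperbolic, the modified field is the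
hyperbolic metric (the chart is an isometry of the hyperbolic model there). [folklore] -/
theorem hatVal_eq_of_thin {x : X} (hx : ∀ (i : Fin k) (q : E4), D.th < q 3 → D.Φ i q = x → q 3 < D.a₀) :
    D.hatVal x = g.val x := by
  unfold hatVal
  split_ifs with h
  · obtain ⟨hq', heq⟩ := h.choose_spec
    have hlt := hx _ _ hq' heq
    have hle : h.choose.2 3 ≤ D.th / 2 := by unfold a₀ at hlt; exact hlt.le
    obtain ⟨h0, h1, h2, h3⟩ := D.c_hyp h.choose.1 (h.choose.2 3) hle
    have key : pushBilin (diagMetric (oneVar (D.c h.choose.1)) h.choose.2)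
        (mfderiv 𝓘(ℝ, E4) (𝓡 4) (D.Φ h.choose.1) h.choose.2) = g.val (D.Φ h.choose.1 h.choose.2) := by
      symm
      refine eq_pushBilin_of_forall (D.injective_mfderiv_Φ _ hq') fun v w ↦ ?_
      exact (S.cusp _).val_mfderiv_cuspChart_eq_diagMetric (D.fr _) (D.region_of_th_lt _ hq')
        h0 h1 h2 h3 v w
    rw [key, heq]
  · rfl

/-! ### The glued field of bilinear forms on `P` -/

/-- `(0, 0) = 0` in `𝔼 2`. [folklore] -/
theorem mk2_zero : mk2 0 0 = (0 : EuclideanSpace ℝ (Fin 2)) := by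
  ext i
  fin_cases i <;> rfl

/-- **The glued field of bilinear forms on the Dehn filling**: on `range jA` the push-forward of
the modified field of `X` along `jA`, on the core tori the push-forward of the flat core form
along the core chart. [cite: Anderson2006, §2.1, (2.4)] -/
def gval (p : P) : E4 →L[ℝ] E4 →L[ℝ] ℝ :=
  open scoped Classical in
  if h : ∃ x, D.jA x = p then pushBilin (D.hatVal h.choose) (mfderiv (𝓡 4) (𝓡 4) D.jA h.choose)
  else if h' : ∃ s : (Σ i : Fin k, D.Vcore i), (s.2 : E4) 2 = 0 ∧ (s.2 : E4) 3 = 0 ∧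
      D.Ψ s.1 s.2 = p then
    pushBilin ((D.fr h'.choose.1).coreForm (D.κ h'.choose.1) (D.lam h'.choose.1) h'.choose.2)
      (mfderiv 𝓘(ℝ, E4) (𝓡 4) (D.Ψ h'.choose.1) h'.choose.2)
  else 0

/-- The value of the glued field on `range jA`. [folklore] -/
theorem gval_jA (x : X) :
    D.gval (D.jA x) = pushBilin (D.hatVal x) (mfderiv (𝓡 4) (𝓡 4) D.jA x) := by
  have h : ∃ x', D.jA x' = D.jA x := ⟨x, rfl⟩
  unfold gval
  rw [dif_pos h, D.injective_jA h.choose_spec]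

/-- **`jA^* gval = hatVal`.** [folklore] -/
theorem gval_pullback_jA (x : X) (v w : E4) :
    D.gval (D.jA x) (mfderiv (𝓡 4) (𝓡 4) D.jA x v) (mfderiv (𝓡 4) (𝓡 4) D.jA x w) =
      D.hatVal x v w := by
  rw [gval_jA]
  exact pushBilin_apply (D.injective_mfderiv_jA x) _ v w

/-- The core chart at a core parameter is a core point `jB ((u, v), 0)`. [folklore] -/
theorem pieceChart_core (i : Fin k) (q : D.Vcore i) (h2 : (q : E4) 2 = 0) (h3 : (q : E4) 3 = 0) :
    pieceChart (D.Vcore i) (D.Vcore_lt_one i) q =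
      ⟨((circlePoint ((q : E4) 0), circlePoint ((q : E4) 1)), 0), by
        rw [mem_fillingPiece_iff]; simp⟩ := by
  apply Subtype.ext
  simp only [coe_pieceChart, pieceParam, h2, h3, mk2_zero]

/-- Core points are not in `range jA`. [folklore] -/
theorem Ψ_not_mem_range (i : Fin k) (q : D.Vcore i) (h2 : (q : E4) 2 = 0) (h3 : (q : E4) 3 = 0) :
    D.Ψ i q ∉ range D.jA := by
  unfold Ψ
  rw [D.pieceChart_core i q h2 h3]
  exact core_not_mem_range D.hrel i _ _ _

/-- Two parameters of the same point of a filling piece give the same push-forward. [folklore] -/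
theorem push_eq_push_of_Ψ_eq {i i' : Fin k} {q : D.Vcore i} {q' : D.Vcore i'}
    (h : D.Ψ i' q' = D.Ψ i q) :
    pushBilin ((D.fr i').coreForm (D.κ i') (D.lam i') q') (mfderiv 𝓘(ℝ, E4) (𝓡 4) (D.Ψ i') q') =
      pushBilin ((D.fr i).coreForm (D.κ i) (D.lam i) q) (mfderiv 𝓘(ℝ, E4) (𝓡 4) (D.Ψ i) q) := by
  have hi : i' = i := by
    by_contra hne
    exact Set.disjoint_left.1 (D.hdisjB hne) ⟨_, rfl⟩ ⟨_, h.symm⟩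
  subst hi
  have heq : pieceChart (D.Vcore i') (D.Vcore_lt_one i') q' =
      pieceChart (D.Vcore i') (D.Vcore_lt_one i') q := D.injective_jB i' h
  have hpc : pieceParam (q' : E4) = pieceParam (q : E4) := congrArg Subtype.val heq
  obtain ⟨k₀, k₁, hk⟩ := exists_shift_of_pieceParam_eq hpc
  have hF : (D.fr i').coreForm (D.κ i') (D.lam i') q' = (D.fr i').coreForm (D.κ i') (D.lam i') q :=
    (D.fr i').coreForm_congr _ _ (by rw [hk]; simp) (by rw [hk]; simp)
  have hd : mfderiv 𝓘(ℝ, E4) (𝓡 4) (D.Ψ i') q' = mfderiv 𝓘(ℝ, E4) (𝓡 4) (D.Ψ i') q := by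
    rw [mfderiv_Ψ, mfderiv_Ψ, heq, hk, mfderiv_pieceParam_add_shift]
    rfl
  rw [hF, hd]

/-- The value of the glued field at a core point. [folklore] -/
theorem gval_Ψ_core (i : Fin k) (q : D.Vcore i) (h2 : (q : E4) 2 = 0) (h3 : (q : E4) 3 = 0) :
    D.gval (D.Ψ i q) =
      pushBilin ((D.fr i).coreForm (D.κ i) (D.lam i) q) (mfderiv 𝓘(ℝ, E4) (𝓡 4) (D.Ψ i) q) := by
  have hn : ¬ ∃ x, D.jA x = D.Ψ i q := fun ⟨x, hx⟩ ↦ D.Ψ_not_mem_range i q h2 h3 ⟨x, hx⟩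
  have h' : ∃ s : (Σ i : Fin k, D.Vcore i), (s.2 : E4) 2 = 0 ∧ (s.2 : E4) 3 = 0 ∧
      D.Ψ s.1 s.2 = D.Ψ i q := ⟨⟨i, q⟩, h2, h3, rfl⟩
  unfold gval
  rw [dif_neg hn, dif_pos h']
  obtain ⟨-, -, heq⟩ := h'.choose_spec
  exact D.push_eq_push_of_Ψ_eq heq

/-- **`Ψ^* gval = F` at core parameters.** [folklore] -/
theorem gval_pullback_Ψ_core (i : Fin k) (q : D.Vcore i) (h2 : (q : E4) 2 = 0) (h3 : (q : E4) 3 = 0)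
    (v w : E4) :
    D.gval (D.Ψ i q) (mfderiv 𝓘(ℝ, E4) (𝓡 4) (D.Ψ i) q v) (mfderiv 𝓘(ℝ, E4) (𝓡 4) (D.Ψ i) q w) =
      (D.fr i).coreForm (D.κ i) (D.lam i) q v w := by
  rw [D.gval_Ψ_core i q h2 h3]
  exact pushBilin_apply (D.injective_mfderiv_Ψ i q) _ v w

/-! ### The polar domain: where the core chart meets the cusp chart -/

/-- The **polar domain** `O i = Ξ⁻¹(V_core i)`: angle-height parameters `(θ₁, θ₂, θ₃, t)` whose
filling-piece point `Ξ(q) = (θ₁, θ₂, e^{-t} e^{iθ₃})` lies in the core domain. [folklore] -/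
def O (i : Fin k) : Opens E4 :=
  ⟨polarMap ⁻¹' (D.Vcore i : Set E4), (D.Vcore i).2.preimage contDiff_polarMap.continuous⟩

/-- Membership in the polar domain. [folklore] -/
@[simp] theorem mem_O {i : Fin k} {r : E4} : r ∈ D.O i ↔ polarMap r ∈ D.Vcore i := Iff.rfl

/-- **Heights in the polar domain are large**: `t > T_max` (since `|w| = e^{-t} < δ = e^{-T_max}`).
[folklore] -/
theorem Tmax_lt_of_mem_O {i : Fin k} {r : E4} (hr : r ∈ D.O i) : D.Tmax i < r 3 := by
  rw [mem_O, mem_Vcore, polarMap_sq_add_sq, δ, sq, sq, ← Real.exp_add, ← Real.exp_add,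
    Real.exp_lt_exp] at hr
  linarith

/-- `t > T` in the polar domain. [folklore] -/
theorem T_lt_of_mem_O {i : Fin k} {r : E4} (hr : r ∈ D.O i) : D.T i < r 3 :=
  lt_of_le_of_lt (le_max_left _ _) (D.Tmax_lt_of_mem_O hr)

/-- `t > 0` in the polar domain. [folklore] -/
theorem pos_of_mem_O {i : Fin k} {r : E4} (hr : r ∈ D.O i) : 0 < r 3 :=
  lt_of_le_of_lt (zero_le_one.trans (le_max_right _ _)) (D.Tmax_lt_of_mem_O hr)

/-- `t > t_h` in the polar domain. [folklore] -/
theorem th_lt_of_mem_O {i : Fin k} {r : E4} (hr : r ∈ D.O i) : D.th < r 3 :=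
  D.th_neg.trans (D.pos_of_mem_O hr)

/-- **The polar map of the domain** `Ξ' : O i → V_core i`. [folklore] -/
def Ξ (i : Fin k) (r : D.O i) : D.Vcore i := ⟨polarMap r.1, r.2⟩

/-- The value of `Ξ'`. [folklore] -/
@[simp] theorem coe_Ξ (i : Fin k) (r : D.O i) : (D.Ξ i r : E4) = polarMap r.1 := rfl

/-- `Ξ'` is smooth. [folklore] -/
theorem contMDiff_Ξ (i : Fin k) : ContMDiff 𝓘(ℝ, E4) 𝓘(ℝ, E4) ∞ (D.Ξ i) :=
  (ContMDiff.subtypeVal_comp_iff (D.Vcore i) (D.Ξ i)).1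
    (contDiff_polarMap.contMDiff.comp contMDiff_subtype_val)

/-- **The differential of `Ξ'` is `DΞ`** (open submanifolds). [folklore] -/
theorem mfderiv_Ξ (i : Fin k) (r : D.O i) :
    mfderiv 𝓘(ℝ, E4) 𝓘(ℝ, E4) (D.Ξ i) r = polarDeriv r.1 := by
  rw [mfderiv_eq_of_coe_comp polarMap (D.Ξ i) (fun _ ↦ rfl) r
    ((D.contMDiff_Ξ i).mdifferentiableAt (by simp))
    (contDiff_polarMap.contMDiff.mdifferentiableAt (by simp)), mfderiv_eq_fderiv, fderiv_polarMap]

/-- **Every non-core point of the core domain is a polar image** of a point of the polar domain.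
[folklore] -/
theorem exists_Ξ_eq {i : Fin k} (q : D.Vcore i) (hq : (q : E4) 2 ≠ 0 ∨ (q : E4) 3 ≠ 0) :
    ∃ r : D.O i, D.Ξ i r = q := by
  obtain ⟨r, hr, -⟩ := exists_polarMap_eq (q : E4) hq
  refine ⟨⟨r, ?_⟩, Subtype.ext hr⟩
  rw [mem_O, hr]
  exact q.2

/-- The core chart after `Ξ'` is the filling-piece point of the filling relation. [folklore] -/
theorem pieceChart_Ξ (i : Fin k) (r : D.O i) :
    pieceChart (D.Vcore i) (D.Vcore_lt_one i) (D.Ξ i r) =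
      piecePoint (r.1 0) (r.1 1) (r.1 2) (exp (-r.1 3)) (exp_pos _).le
        (by rw [exp_lt_one_iff, neg_lt_zero]; exact D.pos_of_mem_O r.2) := by
  apply Subtype.ext
  rw [coe_pieceChart, coe_piecePoint, coe_Ξ]
  refine Prod.ext rfl ?_
  simp only [pieceParam_snd, polarMap_apply_two, polarMap_apply_three]
  ext j
  fin_cases j
  · simp [mk2]
  · simp [mk2]

/-- **The core chart and the cusp chart agree through `Ξ'` and `Lθ`**:
`Ψ (Ξ' r) = jA (Φ (Lθ r))` on the polar domain (the `⇐` direction of the filling relation).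
[cite: Anderson2006, §2.1, (2.2)] -/
theorem Ψ_Ξ (i : Fin k) (r : D.O i) : D.Ψ i (D.Ξ i r) = D.jA (D.Φ i ((D.fr i).thetaToY r.1)) := by
  unfold Ψ Φ
  rw [D.pieceChart_Ξ i r, TorusCusp.cuspChart_thetaToY, ← cuspPt_eq_xTheta,
    ← apply_cusp_eq D.hrel i (r.1 0) (r.1 1) (r.1 2) (exp (-r.1 3)) (exp_pos _)
      (by rw [exp_lt_one_iff, neg_lt_zero]; exact D.pos_of_mem_O r.2), Real.log_exp, neg_neg]

/-- **The differentials agree accordingly**: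
`dΨ_{Ξ' r} ∘ DΞ_r = d(jA)_x ∘ dΦ_{Lθ r} ∘ Lθ`, `x = Φ (Lθ r)`. [folklore] -/
theorem mfderiv_Ψ_comp_polarDeriv (i : Fin k) (r : D.O i) :
    (mfderiv 𝓘(ℝ, E4) (𝓡 4) (D.Ψ i) (D.Ξ i r)).comp (polarDeriv r.1) =
      (mfderiv (𝓡 4) (𝓡 4) D.jA (D.Φ i ((D.fr i).thetaToY r.1))).comp
        ((mfderiv 𝓘(ℝ, E4) (𝓡 4) (D.Φ i) ((D.fr i).thetaToY r.1)).comp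
          ((D.fr i).thetaToY : E4 →L[ℝ] E4)) := by
  have hfun : (D.Ψ i ∘ D.Ξ i : D.O i → P) =
      (D.jA ∘ D.Φ i ∘ ((D.fr i).thetaToY : E4 → E4)) ∘ Subtype.val :=
    funext fun r ↦ D.Ψ_Ξ i r
  have hr3 : D.th < ((D.fr i).thetaToY r.1) 3 := by
    rw [SlopeFrame.thetaToY_apply_three]; exact D.th_lt_of_mem_O r.2
  -- left-hand side
  have hΨ : MDifferentiableAt 𝓘(ℝ, E4) (𝓡 4) (D.Ψ i) (D.Ξ i r) :=
    (D.contMDiff_Ψ i).mdifferentiableAt (by simp)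
  have hΞ : MDifferentiableAt 𝓘(ℝ, E4) 𝓘(ℝ, E4) (D.Ξ i) r :=
    (D.contMDiff_Ξ i).mdifferentiableAt (by simp)
  have h1 := mfderiv_comp r hΨ hΞ
  rw [D.mfderiv_Ξ i r] at h1
  -- right-hand side
  have hjA : MDifferentiableAt (𝓡 4) (𝓡 4) D.jA (D.Φ i ((D.fr i).thetaToY r.1)) :=
    D.contMDiff_jA.mdifferentiableAt (by simp)
  have hΦ : MDifferentiableAt 𝓘(ℝ, E4) (𝓡 4) (D.Φ i) ((D.fr i).thetaToY r.1) :=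
    ((S.cusp i).contMDiffAt_cuspChart (D.fr i) (D.region_of_th_lt i hr3)).mdifferentiableAt
      (by simp)
  have hL : MDifferentiableAt 𝓘(ℝ, E4) 𝓘(ℝ, E4) ((D.fr i).thetaToY : E4 → E4) r.1 :=
    ((D.fr i).thetaToY).mdifferentiableAt
  have hΦL : MDifferentiableAt 𝓘(ℝ, E4) (𝓡 4) (D.Φ i ∘ ((D.fr i).thetaToY : E4 → E4)) r.1 :=
    hΦ.comp r.1 hL
  have h2 := mfderiv_comp r (hjA.comp r.1 hΦL) (OpenSubmanifold.mdifferentiableAt_subtype_val r)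
  rw [OpenSubmanifold.mfderiv_subtype_val] at h2
  have h2' := h2.trans (ContinuousLinearMap.comp_id _)
  rw [mfderiv_comp r.1 hjA hΦL, mfderiv_comp r.1 hΦ hL, ContinuousLinearMap.mfderiv_eq] at h2'
  have h1' : (mfderiv 𝓘(ℝ, E4) (𝓡 4) (D.Ψ i) (D.Ξ i r)).comp (polarDeriv r.1) =
      mfderiv 𝓘(ℝ, E4) (𝓡 4) (D.Ψ i ∘ D.Ξ i) r := h1.symm
  rw [h1', hfun]
  exact h2'

/-- The differential of `Ξ'` is onto. [folklore] -/
theorem surjective_polarDeriv (r : E4) : Surjective (polarDeriv r) :=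
  surjective_of_injective (polarDeriv_injective r)

/-- **`Ψ^* gval = F` at non-core parameters**: through the polar identification
`Ξ^* F = Lθ^* G` (`coreForm_polar`), the agreement of the charts (`Ψ_Ξ`) and the identities
`jA^* gval = hatVal`, `Φ^* hatVal = G`. [cite: Anderson2006, §2.1, (2.4)] -/
theorem gval_pullback_Ψ_Ξ (i : Fin k) (r : D.O i) (v w : E4) :
    D.gval (D.Ψ i (D.Ξ i r)) (mfderiv 𝓘(ℝ, E4) (𝓡 4) (D.Ψ i) (D.Ξ i r) v)
      (mfderiv 𝓘(ℝ, E4) (𝓡 4) (D.Ψ i) (D.Ξ i r) w) =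
      (D.fr i).coreForm (D.κ i) (D.lam i) (D.Ξ i r) v w := by
  obtain ⟨v', rfl⟩ := surjective_polarDeriv r.1 v
  obtain ⟨w', rfl⟩ := surjective_polarDeriv r.1 w
  have hr3 : D.th < ((D.fr i).thetaToY r.1) 3 := by
    rw [SlopeFrame.thetaToY_apply_three]; exact D.th_lt_of_mem_O r.2
  have key : ∀ u : E4, mfderiv 𝓘(ℝ, E4) (𝓡 4) (D.Ψ i) (D.Ξ i r) (polarDeriv r.1 u) =
      mfderiv (𝓡 4) (𝓡 4) D.jA (D.Φ i ((D.fr i).thetaToY r.1))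
        (mfderiv 𝓘(ℝ, E4) (𝓡 4) (D.Φ i) ((D.fr i).thetaToY r.1) ((D.fr i).thetaToY u)) := by
    intro u
    have := congrArg (fun L : E4 →L[ℝ] E4 ↦ L u) (D.mfderiv_Ψ_comp_polarDeriv i r)
    exact this
  rw [key, key, D.Ψ_Ξ i r, D.gval_pullback_jA, D.hatVal_pullback_Φ i hr3]
  obtain ⟨h0, h1, h2, h3⟩ := D.c_core i (r.1 3) (D.T_lt_of_mem_O r.2).le
  rw [coe_Ξ]
  exact ((D.fr i).coreForm_polar (D.slope_ne_zero i) r.1 h0 h1 h2 h3 v' w').symm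

/-- **`Ψ^* gval = F` on the whole core domain.** [folklore] -/
theorem gval_pullback_Ψ (i : Fin k) (q : D.Vcore i) (v w : E4) :
    D.gval (D.Ψ i q) (mfderiv 𝓘(ℝ, E4) (𝓡 4) (D.Ψ i) q v) (mfderiv 𝓘(ℝ, E4) (𝓡 4) (D.Ψ i) q w) =
      (D.fr i).coreForm (D.κ i) (D.lam i) q v w := by
  by_cases h : (q : E4) 2 = 0 ∧ (q : E4) 3 = 0
  · exact D.gval_pullback_Ψ_core i q h.1 h.2 v w
  · have hq : (q : E4) 2 ≠ 0 ∨ (q : E4) 3 ≠ 0 := by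
      by_contra hc
      push Not at hc
      exact h ⟨by simpa using hc.1, by simpa using hc.2⟩
    obtain ⟨r, rfl⟩ := D.exists_Ξ_eq q hq
    exact D.gval_pullback_Ψ_Ξ i r v w

/-! ### The thin part and the covering -/

/-- **The thin part** `W = X ∖ ⋃_i C_i '' {t ≥ a₀}`: an open set (the modified regions are
closed, `isClosed_image_Ici`). [folklore] -/
def thin [T2Space X] [T2Space P] : Opens X :=
  ⟨(⋃ i, (S.cusp i) '' {p | D.a₀ ≤ p.2})ᶜ, by
    rw [isOpen_compl_iff]
    exact isClosed_iUnion_of_finite fun i ↦ isClosed_image_Ici D.hrel D.continuous_jA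
      D.continuous_jB D.hdet i (lt_trans (D.neg_eps_lt_th i) D.th_lt_a₀)⟩

/-- On the thin part all cusp parameters have height `< a₀`. [folklore] -/
theorem height_lt_of_mem_thin [T2Space X] [T2Space P] {x : X} (hx : x ∈ D.thin) (i : Fin k)
    (q : E4) (_hq : D.th < q 3) (h : D.Φ i q = x) : q 3 < D.a₀ := by
  by_contra hle
  rw [not_lt] at hle
  apply hx
  rw [mem_iUnion]
  exact ⟨i, (TorusCusp.yToX (D.fr i) q), by simpa using hle, h⟩

/-- **`hatVal = g` on the thin part.** [folklore] -/
theorem hatVal_eq_of_mem_thin [T2Space X] [T2Space P] {x : X} (hx : x ∈ D.thin) :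
    D.hatVal x = g.val x :=
  D.hatVal_eq_of_thin fun i q hq h ↦ D.height_lt_of_mem_thin hx i q hq h

/-- Every point of `E3` has straightened coordinates: `C (x, t) = Φ (⟨x,u₀⟩, ⟨x,u₁⟩, ⟨x,u₂⟩, t)`.
[folklore] -/
theorem apply_eq_Φ (i : Fin k) (x : E3) (t : ℝ) :
    (S.cusp i) (x, t) = D.Φ i (mk4 ⟪x, (D.fr i).u 0⟫_ℝ ⟪x, (D.fr i).u 1⟫_ℝ ⟪x, (D.fr i).u 2⟫_ℝ t) := by
  unfold Φ TorusCusp.cuspChart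
  rw [TorusCusp.yToX_apply]
  congr 1
  refine Prod.ext ?_ rfl
  simp only
  rw [Fin.sum_univ_three]
  have := (D.fr i).sum_inner_smul x
  rw [Fin.sum_univ_three] at this
  simp only [Fin.castSucc_zero, Fin.castSucc_one, show Fin.castSucc (2 : Fin 3) = (2 : Fin 4) from rfl,
    mk4_apply_zero, mk4_apply_one, mk4_apply_two]
  exact this.symm

/-- **The covering of the Dehn filling** by the thin part, the enlarged cusps and the core
charts. [folklore] -/
theorem cover [T2Space X] [T2Space P] (p : P) :
    (∃ x ∈ D.thin, D.jA x = p) ∨ (∃ (i : Fin k) (q : E4), D.th < q 3 ∧ D.jA (D.Φ i q) = p) ∨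
      (∃ (i : Fin k) (q : D.Vcore i), D.Ψ i q = p) := by
  by_cases hp : p ∈ range D.jA
  · obtain ⟨x, rfl⟩ := hp
    by_cases hx : x ∈ D.thin
    · exact Or.inl ⟨x, hx, rfl⟩
    · -- `x` lies in a modified region `C_i '' {t ≥ a₀}`
      have hx' : x ∈ ⋃ i, (S.cusp i) '' {p | D.a₀ ≤ p.2} := by
        by_contra h; exact hx h
      rw [mem_iUnion] at hx'
      obtain ⟨i, ⟨x', t⟩, (ht : D.a₀ ≤ t), rfl⟩ := hx'
      refine Or.inr (Or.inl ⟨i, mk4 ⟪x', (D.fr i).u 0⟫_ℝ ⟪x', (D.fr i).u 1⟫_ℝ ⟪x', (D.fr i).u 2⟫_ℝ t,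
        ?_, by rw [← D.apply_eq_Φ i x' t]⟩)
      simpa using lt_of_lt_of_le D.th_lt_a₀ ht
  · obtain ⟨i, u, v, hmem, rfl⟩ := exists_core_of_not_mem_range D.hrel D.hcover hp
    obtain ⟨θ₁, rfl⟩ := circlePoint_surjective u
    obtain ⟨θ₂, rfl⟩ := circlePoint_surjective v
    have hmem' : mk4 θ₁ θ₂ 0 0 ∈ D.Vcore i := by
      rw [mem_Vcore]
      simpa using pow_pos (D.δ_pos i) 2
    refine Or.inr (Or.inr ⟨i, ⟨mk4 θ₁ θ₂ 0 0, hmem'⟩, ?_⟩)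
    unfold Ψ
    congr 1
    apply Subtype.ext
    simp only [coe_pieceChart, pieceParam, mk4_apply_zero, mk4_apply_one, mk4_apply_two,
      mk4_apply_three, mk2_zero]

end TwoPiSetup

end Literature.Geometry.Riemannian
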